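import Summits.Ventures.AbcSig.Rows.Bridge
import Summits.Ventures.AbcSig.Rows.C2aL277A0X
import Summits.Ventures.AbcSig.Rows.C2aL277A0XAB

/-!
# Venture AbcSig — CELL `C2aL277A0`: the census statement `Rows.C2aCellRed 277 (fun a => a = 0) {11}` from the two row theorems

HONEST FRAMING. COMPUTATION cell `pub-abcsig`; CONDITIONAL theorem; no claim on ABC or any summit. Hypotheses exactly as
in `Rows/C2aL277A0X.lean` and `Rows/C2aL277A0XAB.lean`: `BS04Package` (CITED), `DataComplete …` (COMPUTED level files), `EisPackage` (CITED) and `Refines` (COMPUTED) for the M6 orbits discharged in the kernel, and the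
rows' per-orbit exclusions for `famB` as universally quantified hypotheses (CITED: the census
row's certificates). Conclusion = p1's census predicate (`Rows/Statements.lean`), all four coprime coefficient
distributions `A·B = 2^a·277^m`, reduced exponents `a < n`, `m < n` (RULING H1). GENERATED by p-lean gen/make_rows.py
(after plean/make_cell_bridges.py).
-/

namespace Summit.Ventures.AbcSig

/-- Cell `C2aL277A0` (M6 orbits discharged in the kernel): `Rows.C2aCellRed 277 (fun a => a = 0) {11}` under the rows' hypotheses. -/
theorem xcell_C2aL277A0 (M : NewformModel) (hP : M.BS04Package)
    (hE : M.EisPackage)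
    (hD554 : M.DataComplete 554 level554Orbits)
    (hD8864 : M.DataComplete 8864 level8864Orbits)
    (hR_orbit_554_4 : M.Refines 554 orbit_554_4 m6X_554_4)
    (hX_orbit_8864_4 : ∀ n m : ℕ, n ∈ ([37] : List ℕ) → M.Excludes 8864 orbit_8864_4 (famB (2 ^ 0 * 277 ^ m) n (fun _ _ => True)))
    (hX_orbit_8864_9 : ∀ n m : ℕ, n ∈ ([13] : List ℕ) → M.Excludes 8864 orbit_8864_9 (famB (2 ^ 0 * 277 ^ m) n (fun _ _ => True))) :
    Rows.C2aCellRed 277 (fun a => a = 0) {11} :=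
  C2aCellRed_of_rows 277 (by norm_num) (by norm_num) _ _
    (fun n hn h11 hnℓ hR a m (ha : a = 0) han hm hmn x y z h1 h2 => by
      subst ha
      exact
 xrow_C2aL277A0 M hP hE hD554 hD8864 hR_orbit_554_4 n hn h11 hnℓ (by simpa using hR) m hm hmn (hX_orbit_8864_4 n m) (hX_orbit_8864_9 n m) x y z h1 h2)
    (fun n hn h11 hnℓ hR a m (ha : a = 0) han hm hmn x y z h1 h2 => by
      subst ha
      exact
 xrow_C2aL277A0AB M hP hE hD554 hD8864 hR_orbit_554_4 n hn h11 hnℓ (by simpa using hR) m hm hmn (hX_orbit_8864_4 n m) (hX_orbit_8864_9 n m) x y z h1 h2)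

end Summit.Ventures.AbcSig
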